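import Literature.AlgebraicGeometry.HodgeTheory.WeilClassesFieldSubfieldExteriorProducts
import Literature.AlgebraicGeometry.HodgeTheory.AlgebraicClassesCupAbelianVarietyDiagonal
import Literature.AlgebraicGeometry.HodgeTheory.WeilClassesFieldOneClass
import Literature.AlgebraicGeometry.Deligne1982.WeilTypeCMHodgeRing
import HarnessLib

/-!
# Weil classes of a SUBFIELD `F = ℚ(S(φ)) ⊆ F′ = ℚ(φ)`, III: `W_{F′}` algebraic ⟹ `W_F` algebraic for `[F′:F] = 2`
# (Moonen–Zarhin 1998, Remark (1), with Voisin's Prop. 9.20 on an abelian variety)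

Layer `Literature/AlgebraicGeometry/HodgeTheory`, theorem-only rider on `WeilClassesFieldSubfieldExteriorProducts`
(for a subfield of index two, `weilClassesField A ψ Q (r + r) ⊆ span_ℂ {a ⌣ b | a, b ∈ weilClassesField A φ P r}` —
Moonen–Zarhin's «`W_F` is contained in the vector subspace generated by exterior products of elements of `W_{F′}`»)
and on `AlgebraicClassesCupAbelianVarietyDiagonal` (`AbelianVariety.cupProduct_mem_algebraicClasses'`: on a complex
abelian variety the cup product of algebraic classes is algebraic, unconditionally — Voisin II Prop. 9.20 via
Kleiman's moving on abelian varieties).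

PRINTED STATEMENT.  B. J. J. Moonen – Yu. G. Zarhin, *Weil classes on abelian varieties*, J. reine angew. Math. 496
(1998) = arXiv:alg-geom/9612017, section «In practice…», Remark (1) (held text `paper:arxiv-alg-geom_9612017`, chunk
p0004): «Furthermore, if `F ⊆ F′` then we have the implication `W_{F′}` consists of decomposable Hodge classes ⟹ `W_F`
consists of decomposable Hodge classes.  This is a direct consequence of Criterion (crit2).  It can also be seen more
directly, by using that `W_F` is contained in the vector subspace generated by exterior products of elements of
`W_{F′}`.»  The same sentence with «decomposable Hodge classes» (= the subalgebra generated by divisor classes)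
replaced by ANY subalgebra of `H^{2•}` containing `W_{F′}` — here the subalgebra of ALGEBRAIC classes (C. Voisin, *Hodge
Theory and Complex Algebraic Geometry II*, Prop. 9.20 «`cl(Z · Z′) = cl(Z) ∪ cl(Z′)`», proved in the tree for abelian
varieties) — gives: `W_{F′} ⊗ ℂ` algebraic ⟹ `W_F ⊗ ℂ` algebraic.

WHAT IS PROVED (theorems only; no definition, no named fact), for `P ∈ ℤ[T]` monic irreducible over `ℚ` of degree
`e` with `P(φ) = 0`, `ψ = S(φ)`, and `Q ∈ ℤ[T]` every complex root `μ` of which has EXACTLY TWO roots of `P` above it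
(`[F′:F] = 2`):
* §1 `weilClassesField_le_span_cupProduct_of_eq_eval₂'` — the index-two containment of
  `WeilClassesFieldSubfieldExteriorProducts` §4 read in any target degree `n = r + r` (so that it meets the tree's
  `cupProduct h` terms with `h : 2m + 2m = 2(m + m)`).
* §2 **`weilClassesField_le_algebraicClasses_of_eq_eval₂`** — `e · 2m = 2 dim A` and
  `weilClassesField A φ P (2m) ⊆ algebraicClasses A.X m` ⟹ `weilClassesField A ψ Q (2(m + m)) ⊆ algebraicClasses A.X (m + m)`.
* §3 **`weilClassesField_le_algebraicClasses_of_isRationalClass_of_eq_eval₂`** — with the one-class lemma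
  (`weilClassesField_le_algebraicClasses_of_isRationalClass_of_ne_zero`, Markman §4 / Moonen–Zarhin «`dim_F W_F = 1`»):
  ONE non-zero rational algebraic class in `W_{F′} ⊗ ℂ` (`m > 0`) makes `W_F ⊗ ℂ` algebraic for the index-two subfield.
* §4 `two_roots_above_of_eq_comp_X_sq` — the index-two hypothesis holds for `ψ = φ²`: `P = R(T²)` with `R(0) ≠ 0`,
  `S = T²`, `Q = R` (above a root `μ` of `R` lie exactly `±√μ`) — the shape of Deligne's `E = ℚ[T]/(R(T²)) ⊃ E₀`;
  `weilClassesField_sq_le_span_cupProduct`, `weilClassesField_sq_le_algebraicClasses` — §1, §2 for `W_{ℚ(φ²)}`.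
* §5 `weilClassesField_sq_le_span_cupProduct_of_isWeilTypeCM`, `weilClassesField_sq_le_algebraicClasses_of_isWeilTypeCM`
  — the same for Deligne's Weil-type CM data `Deligne1982.IsWeilTypeCM A η R e₀ k` and `E₀ = ℚ(η²) ⊂ E = ℚ(η)`
  (`W_{E₀} ⊗ ℂ ⊆ span {a ⌣ b | a, b ∈ W_E ⊗ ℂ}`; `W_E ⊗ ℂ` algebraic ⟹ `W_{E₀} ⊗ ℂ` algebraic).

No `sorry`; axioms `propext`, `Classical.choice`, `Quot.sound`.

## References
* [MoonenZarhin1998WeilClasses] B. J. J. Moonen, Yu. G. Zarhin, *Weil classes on abelian varieties*, J. reine angew.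
  Math. 496 (1998) 83–92 = arXiv:alg-geom/9612017, Remark (1) (chunk p0004); §1 «`dim_F W_F = 1`» (chunk p0001).
* [VoisinHodgeII2003] C. Voisin, *Hodge Theory and Complex Algebraic Geometry II* (2003), Prop. 9.20.
* [Markman2025SurveySecant] E. Markman, arXiv:2509.23403, §4 (one algebraic class on the `K`-line suffices).
* [Deligne1982HodgeCycles] P. Deligne (notes by J. S. Milne), LNM 900 (1982), §4 (4.4) (PDF p. 46).
-/

noncomputable section

open CategoryTheory Polynomial

namespace Literature.AlgebraicGeometry.HodgeTheory

section HodgeTheory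

open Literature.AlgebraicTopology.SingularHomology
open Literature.AlgebraicGeometry.Motives (IsSmoothProjective)

variable {A : Motives.AbelianVariety ℂ} {φ ψ : A ⟶ A} {P S Q : Polynomial ℤ} {e r : ℕ}

/-! ### §1 The index-two containment in any target degree -/

/-- `WeilClassesFieldSubfieldExteriorProducts` §4 with an arbitrary proof `h : r + r = n` of the degree identity:
`weilClassesField A ψ Q n ⊆ span_ℂ {cupProduct h a b | a, b ∈ weilClassesField A φ P r}`.
[cite: MoonenZarhin1998WeilClasses, Remark (1), last sentence (chunk p0004)] -/
theorem weilClassesField_le_span_cupProduct_of_eq_eval₂' (hPm : P.Monic) (hPe : P.natDegree = e)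
    (hPirr : Irreducible (P.map (Int.castRingHom ℚ)))
    (hφ : Polynomial.eval₂ (Int.castRingHom (CategoryTheory.End A)) (φ : CategoryTheory.End A) P = 0)
    (her : e * r = 2 * A.dim)
    (hψ : (ψ : CategoryTheory.End A) =
      Polynomial.eval₂ (Int.castRingHom (CategoryTheory.End A)) (φ : CategoryTheory.End A) S)
    (hfib : ∀ μ : ℂ, Polynomial.eval₂ (Int.castRingHom ℂ) μ Q = 0 → ∃ ρ₁ ρ₂ : ℂ, ρ₁ ≠ ρ₂ ∧
      Polynomial.eval₂ (Int.castRingHom ℂ) ρ₁ P = 0 ∧ Polynomial.eval₂ (Int.castRingHom ℂ) ρ₂ P = 0 ∧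
      Polynomial.eval₂ (Int.castRingHom ℂ) ρ₁ S = μ ∧ Polynomial.eval₂ (Int.castRingHom ℂ) ρ₂ S = μ ∧
      ∀ ρ : ℂ, Polynomial.eval₂ (Int.castRingHom ℂ) ρ P = 0 →
        Polynomial.eval₂ (Int.castRingHom ℂ) ρ S = μ → ρ = ρ₁ ∨ ρ = ρ₂)
    {n : ℕ} (h : r + r = n) :
    weilClassesField A ψ Q n ≤
      Submodule.span ℂ (Set.image2 (fun a b => cupProduct h a b)
        (weilClassesField A φ P r : Set (complexBetti A.X r)) (weilClassesField A φ P r)) := by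
  subst h
  exact weilClassesField_le_span_cupProduct_of_eq_eval₂ hPm hPe hPirr hφ her hψ hfib

/-! ### §2 `W_{F′} ⊗ ℂ` algebraic ⟹ `W_F ⊗ ℂ` algebraic, `[F′ : F] = 2` -/

/-- **ALGEBRAICITY OF THE WEIL CLASSES DESCENDS TO A SUBFIELD OF INDEX TWO.**  Let `P ∈ ℤ[T]` be monic, irreducible
over `ℚ`, of degree `e`, with `P(φ) = 0` and `e · 2m = 2 dim A`; let `ψ = S(φ)` and let `Q ∈ ℤ[T]` be such that above
every complex root `μ` of `Q` there are exactly two roots of `P` (`F = ℚ(ψ) ⊆ F′ = ℚ(φ)` of index `2`).  If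
`W_{F′} ⊗ ℂ = weilClassesField A φ P (2m)` consists of algebraic classes, so does
`W_F ⊗ ℂ = weilClassesField A ψ Q (2(m + m))`: it lies in the span of the cup products `a ⌣ b` of pairs of classes
of `W_{F′} ⊗ ℂ` (Moonen–Zarhin, Remark (1)), and those are algebraic (Voisin II Prop. 9.20 on the abelian variety
`A`, `AbelianVariety.cupProduct_mem_algebraicClasses'`). [cite: MoonenZarhin1998WeilClasses, Remark (1) (chunk p0004)]
[cite: VoisinHodgeII2003, Prop. 9.20] -/
theorem weilClassesField_le_algebraicClasses_of_eq_eval₂ {m : ℕ} (hPm : P.Monic) (hPe : P.natDegree = e)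
    (hPirr : Irreducible (P.map (Int.castRingHom ℚ)))
    (hφ : Polynomial.eval₂ (Int.castRingHom (CategoryTheory.End A)) (φ : CategoryTheory.End A) P = 0)
    (her : e * (2 * m) = 2 * A.dim)
    (hψ : (ψ : CategoryTheory.End A) =
      Polynomial.eval₂ (Int.castRingHom (CategoryTheory.End A)) (φ : CategoryTheory.End A) S)
    (hfib : ∀ μ : ℂ, Polynomial.eval₂ (Int.castRingHom ℂ) μ Q = 0 → ∃ ρ₁ ρ₂ : ℂ, ρ₁ ≠ ρ₂ ∧
      Polynomial.eval₂ (Int.castRingHom ℂ) ρ₁ P = 0 ∧ Polynomial.eval₂ (Int.castRingHom ℂ) ρ₂ P = 0 ∧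
      Polynomial.eval₂ (Int.castRingHom ℂ) ρ₁ S = μ ∧ Polynomial.eval₂ (Int.castRingHom ℂ) ρ₂ S = μ ∧
      ∀ ρ : ℂ, Polynomial.eval₂ (Int.castRingHom ℂ) ρ P = 0 →
        Polynomial.eval₂ (Int.castRingHom ℂ) ρ S = μ → ρ = ρ₁ ∨ ρ = ρ₂)
    (hW : weilClassesField A φ P (2 * m) ≤ algebraicClasses A.X m) :
    weilClassesField A ψ Q (2 * (m + m)) ≤ algebraicClasses A.X (m + m) := by
  have h : 2 * m + 2 * m = 2 * (m + m) := by ring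
  refine (weilClassesField_le_span_cupProduct_of_eq_eval₂' hPm hPe hPirr hφ her hψ hfib h).trans ?_
  rw [Submodule.span_le]
  rintro _ ⟨a, ha, b, hb, rfl⟩
  exact AbelianVariety.cupProduct_mem_algebraicClasses' A h (hW ha) (hW hb)

/-! ### §3 One non-zero rational algebraic class of `W_{F′} ⊗ ℂ` makes `W_F ⊗ ℂ` algebraic -/

/-- **One non-zero rational algebraic Weil class for `F′` ⟹ all Weil classes of the index-two subfield `F` are
algebraic**: by the one-class lemma (`weilClassesField_le_algebraicClasses_of_isRationalClass_of_ne_zero`: the `F′`-line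
`W_{F′}` is spanned over `F′ ⊂ End⁰(A)`, acting by algebraic correspondences, by any non-zero rational class) the whole
of `W_{F′} ⊗ ℂ` is algebraic, and §2 descends this to `W_F ⊗ ℂ`.
[cite: MoonenZarhin1998WeilClasses, §1 (dim_F W_F = 1) and Remark (1) (chunks p0001, p0004)]
[cite: Markman2025SurveySecant, §4] [cite: VoisinHodgeII2003, Prop. 9.20] -/
theorem weilClassesField_le_algebraicClasses_of_isRationalClass_of_eq_eval₂ {m : ℕ} (hPm : P.Monic)
    (hPe : P.natDegree = e) (hPirr : Irreducible (P.map (Int.castRingHom ℚ)))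
    (hφ : Polynomial.eval₂ (Int.castRingHom (CategoryTheory.End A)) (φ : CategoryTheory.End A) P = 0)
    (her : e * (2 * m) = 2 * A.dim) (hm : 0 < m)
    (hψ : (ψ : CategoryTheory.End A) =
      Polynomial.eval₂ (Int.castRingHom (CategoryTheory.End A)) (φ : CategoryTheory.End A) S)
    (hfib : ∀ μ : ℂ, Polynomial.eval₂ (Int.castRingHom ℂ) μ Q = 0 → ∃ ρ₁ ρ₂ : ℂ, ρ₁ ≠ ρ₂ ∧
      Polynomial.eval₂ (Int.castRingHom ℂ) ρ₁ P = 0 ∧ Polynomial.eval₂ (Int.castRingHom ℂ) ρ₂ P = 0 ∧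
      Polynomial.eval₂ (Int.castRingHom ℂ) ρ₁ S = μ ∧ Polynomial.eval₂ (Int.castRingHom ℂ) ρ₂ S = μ ∧
      ∀ ρ : ℂ, Polynomial.eval₂ (Int.castRingHom ℂ) ρ P = 0 →
        Polynomial.eval₂ (Int.castRingHom ℂ) ρ S = μ → ρ = ρ₁ ∨ ρ = ρ₂)
    {γ : complexBetti A.X (2 * m)} (hγW : γ ∈ weilClassesField A φ P (2 * m)) (hγQ : IsRationalClass γ)
    (hγ0 : γ ≠ 0) (hγalg : γ ∈ algebraicClasses A.X m) :
    weilClassesField A ψ Q (2 * (m + m)) ≤ algebraicClasses A.X (m + m) :=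
  weilClassesField_le_algebraicClasses_of_eq_eval₂ hPm hPe hPirr hφ her hψ hfib
    (weilClassesField_le_algebraicClasses_of_isRationalClass_of_ne_zero hPe hPirr hφ her hm hγW hγQ hγ0 hγalg)

/-! ### §4 The fibres of `ψ = φ²`: `P = R(T²)`, `S = T²`, `Q = R` — above a root `μ ≠ 0` of `R` lie `±√μ` -/

/-- **The index-two hypothesis for `ψ = φ²`.**  If `P = R(T²)` and `0` is not a root of `R`, then above every complex
root `μ` of `R` there are exactly two roots of `P` with respect to `S = T²`, namely the two square roots `±√μ` of `μ`
(`P(±√μ) = R(μ) = 0`, and `ρ² = μ = (√μ)²` forces `ρ = ±√μ`).  This is the shape of Deligne's presentation of a CM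
field of Weil type, `E = ℚ[T]/(R(T²)) ⊃ E₀ = ℚ[T]/(R)` its maximal totally real subfield (LNM 900 §5, proof of
Prop. 5.1: «`E = F[√α]`, `F` totally real»), for which the theorems above apply to `F′ = E ⊇ F = E₀`.
[cite: Deligne1982HodgeCycles, §5, proof of Prop. 5.1 (PDF pp. 53–54)] [cite: MoonenZarhin1998WeilClasses, Remark (1) (chunk p0004)] -/
theorem two_roots_above_of_eq_comp_X_sq {P R : Polynomial ℤ} (hP : P = R.comp (Polynomial.X ^ 2))
    (hR0 : Polynomial.eval₂ (Int.castRingHom ℂ) 0 R ≠ 0) :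
    ∀ μ : ℂ, Polynomial.eval₂ (Int.castRingHom ℂ) μ R = 0 → ∃ ρ₁ ρ₂ : ℂ, ρ₁ ≠ ρ₂ ∧
      Polynomial.eval₂ (Int.castRingHom ℂ) ρ₁ P = 0 ∧ Polynomial.eval₂ (Int.castRingHom ℂ) ρ₂ P = 0 ∧
      Polynomial.eval₂ (Int.castRingHom ℂ) ρ₁ (Polynomial.X ^ 2 : Polynomial ℤ) = μ ∧
      Polynomial.eval₂ (Int.castRingHom ℂ) ρ₂ (Polynomial.X ^ 2 : Polynomial ℤ) = μ ∧
      ∀ ρ : ℂ, Polynomial.eval₂ (Int.castRingHom ℂ) ρ P = 0 →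
        Polynomial.eval₂ (Int.castRingHom ℂ) ρ (Polynomial.X ^ 2 : Polynomial ℤ) = μ → ρ = ρ₁ ∨ ρ = ρ₂ := by
  intro μ hμ
  obtain ⟨z, hz⟩ := IsAlgClosed.exists_pow_nat_eq μ (by norm_num : 0 < 2)
  have hμ0 : μ ≠ 0 := by
    rintro rfl
    exact hR0 hμ
  have hz0 : z ≠ 0 := by
    rintro rfl
    exact hμ0 (by rw [← hz, zero_pow two_ne_zero])
  have hPz : ∀ w : ℂ, w ^ 2 = μ → Polynomial.eval₂ (Int.castRingHom ℂ) w P = 0 := by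
    intro w hw
    rw [hP, Polynomial.eval₂_comp, Polynomial.eval₂_X_pow, hw, hμ]
  refine ⟨z, -z, fun h => hz0 ?_, hPz z hz, hPz (-z) (by rw [neg_sq, hz]),
    by rw [Polynomial.eval₂_X_pow, hz], by rw [Polynomial.eval₂_X_pow, neg_sq, hz], fun ρ _ hρ => ?_⟩
  · have h2 : (2 : ℂ) * z = 0 := by rw [two_mul]; nth_rw 2 [h]; exact add_neg_cancel z
    exact (mul_eq_zero.1 h2).resolve_left two_ne_zero
  · rw [Polynomial.eval₂_X_pow, ← hz] at hρ
    exact sq_eq_sq_iff_eq_or_eq_neg.1 hρ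

/-- **`W_{ℚ(φ²)} ⊗ ℂ ⊆ span {a ⌣ b | a, b ∈ W_{ℚ(φ)} ⊗ ℂ}` for `P = R(T²)`** (`φ` a root of `R(T²)` irreducible over `ℚ`,
`0` not a root of `R`, `e · r = 2 dim A`): the instance `S = T²`, `Q = R` of §1.
[cite: MoonenZarhin1998WeilClasses, Remark (1), last sentence (chunk p0004)] [cite: Deligne1982HodgeCycles, §5 Prop. 5.1] -/
theorem weilClassesField_sq_le_span_cupProduct {R : Polynomial ℤ} (hP : P = R.comp (Polynomial.X ^ 2))
    (hR0 : Polynomial.eval₂ (Int.castRingHom ℂ) 0 R ≠ 0) (hPm : P.Monic) (hPe : P.natDegree = e)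
    (hPirr : Irreducible (P.map (Int.castRingHom ℚ)))
    (hφ : Polynomial.eval₂ (Int.castRingHom (CategoryTheory.End A)) (φ : CategoryTheory.End A) P = 0)
    (her : e * r = 2 * A.dim)
    (hψ : (ψ : CategoryTheory.End A) =
      Polynomial.eval₂ (Int.castRingHom (CategoryTheory.End A)) (φ : CategoryTheory.End A)
        (Polynomial.X ^ 2 : Polynomial ℤ))
    {n : ℕ} (h : r + r = n) :
    weilClassesField A ψ R n ≤
      Submodule.span ℂ (Set.image2 (fun a b => cupProduct h a b)
        (weilClassesField A φ P r : Set (complexBetti A.X r)) (weilClassesField A φ P r)) :=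
  weilClassesField_le_span_cupProduct_of_eq_eval₂' hPm hPe hPirr hφ her hψ
    (two_roots_above_of_eq_comp_X_sq hP hR0) h

/-- **Algebraicity descends from `W_{ℚ(φ)}` to `W_{ℚ(φ²)}`** (`P = R(T²)` as above, `e · 2m = 2 dim A`): if
`weilClassesField A φ P (2m)` consists of algebraic classes then so does `weilClassesField A ψ R (2(m + m))` for
`ψ = φ²`. [cite: MoonenZarhin1998WeilClasses, Remark (1) (chunk p0004)] [cite: VoisinHodgeII2003, Prop. 9.20] -/
theorem weilClassesField_sq_le_algebraicClasses {R : Polynomial ℤ} {m : ℕ} (hP : P = R.comp (Polynomial.X ^ 2))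
    (hR0 : Polynomial.eval₂ (Int.castRingHom ℂ) 0 R ≠ 0) (hPm : P.Monic) (hPe : P.natDegree = e)
    (hPirr : Irreducible (P.map (Int.castRingHom ℚ)))
    (hφ : Polynomial.eval₂ (Int.castRingHom (CategoryTheory.End A)) (φ : CategoryTheory.End A) P = 0)
    (her : e * (2 * m) = 2 * A.dim)
    (hψ : (ψ : CategoryTheory.End A) =
      Polynomial.eval₂ (Int.castRingHom (CategoryTheory.End A)) (φ : CategoryTheory.End A)
        (Polynomial.X ^ 2 : Polynomial ℤ))
    (hW : weilClassesField A φ P (2 * m) ≤ algebraicClasses A.X m) :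
    weilClassesField A ψ R (2 * (m + m)) ≤ algebraicClasses A.X (m + m) :=
  weilClassesField_le_algebraicClasses_of_eq_eval₂ hPm hPe hPirr hφ her hψ
    (two_roots_above_of_eq_comp_X_sq hP hR0) hW

/-! ### §5 Deligne's Weil-type CM data `(A, η)`, `E = ℚ(η) ⊃ E₀ = ℚ(η²)`: `W_{E₀} ⊗ ℂ ⊆ span {a ⌣ b | a, b ∈ W_E ⊗ ℂ}` -/

/-- For a Weil-type CM datum `Deligne1982.IsWeilTypeCM A η R e₀ k` (`E = ℚ(η) ≅ ℚ[T]/(R(T²))` a CM field of degree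
`2e₀`, `dim A = 2k·e₀`, `W_E ⊗ ℂ = weilClassesField A η (R(T²)) (2k)`), `0` is not a root of `R` (the roots of `R` are
real and negative). [cite: Deligne1982HodgeCycles, §4 (4.4) and §5 proof of Prop. 5.1 (PDF pp. 46, 53–54)] -/
theorem eval₂_zero_ne_zero_of_isWeilTypeCM {η : A ⟶ A} {R : Polynomial ℤ} {e₀ k : ℕ}
    (hW : Deligne1982.IsWeilTypeCM A η R e₀ k) : Polynomial.eval₂ (Int.castRingHom ℂ) 0 R ≠ 0 := by
  intro h0
  have h := (hW.root_real_neg 0 h0).2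
  rw [Complex.zero_re] at h
  exact lt_irrefl _ h

/-- **`W_{E₀} ⊗ ℂ ⊆ span_ℂ {a ⌣ b | a, b ∈ W_E ⊗ ℂ}` for Deligne's `(A, η)` of Weil type and its maximal totally real
subfield `E₀ = ℚ(η²) ⊂ E = ℚ(η)`** (`ψ = η²`, `W_{E₀} ⊗ ℂ = weilClassesField A ψ R (2k + 2k)`): Moonen–Zarhin's
Remark (1) containment for the index-two pair `E₀ ⊂ E` (§4 with `P = R(T²)`, `e = 2e₀`, `r = 2k`,
`e · r = 2 dim A`). [cite: MoonenZarhin1998WeilClasses, Remark (1), last sentence (chunk p0004)]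
[cite: Deligne1982HodgeCycles, §4 (4.4), §5 Prop. 5.1] -/
theorem weilClassesField_sq_le_span_cupProduct_of_isWeilTypeCM {η : A ⟶ A} {R : Polynomial ℤ} {e₀ k : ℕ}
    (hW : Deligne1982.IsWeilTypeCM A η R e₀ k)
    (hψ : (ψ : CategoryTheory.End A) =
      Polynomial.eval₂ (Int.castRingHom (CategoryTheory.End A)) (η : CategoryTheory.End A)
        (Polynomial.X ^ 2 : Polynomial ℤ))
    {n : ℕ} (h : 2 * k + 2 * k = n) :
    weilClassesField A ψ R n ≤
      Submodule.span ℂ (Set.image2 (fun a b => cupProduct h a b)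
        (weilClassesField A η (R.comp (Polynomial.X ^ 2)) (2 * k) : Set (complexBetti A.X (2 * k)))
        (weilClassesField A η (R.comp (Polynomial.X ^ 2)) (2 * k))) :=
  weilClassesField_sq_le_span_cupProduct rfl (eval₂_zero_ne_zero_of_isWeilTypeCM hW) hW.monic_comp
    hW.natDegree_comp hW.irreducible hW.eval₂_eq_zero (by rw [hW.dim_eq]; ring) hψ h

/-- **`W_E ⊗ ℂ` algebraic ⟹ `W_{E₀} ⊗ ℂ` algebraic** for Deligne's `(A, η)` of Weil type, `E₀ = ℚ(η²)`:
`weilClassesField A η (R(T²)) (2k) ⊆ algebraicClasses A.X k ⟹ weilClassesField A (η²) R (2(k + k)) ⊆ algebraicClasses A.X (k + k)`.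
[cite: MoonenZarhin1998WeilClasses, Remark (1) (chunk p0004)] [cite: VoisinHodgeII2003, Prop. 9.20]
[cite: Deligne1982HodgeCycles, §4 (4.4)] -/
theorem weilClassesField_sq_le_algebraicClasses_of_isWeilTypeCM {η : A ⟶ A} {R : Polynomial ℤ} {e₀ k : ℕ}
    (hW : Deligne1982.IsWeilTypeCM A η R e₀ k)
    (hψ : (ψ : CategoryTheory.End A) =
      Polynomial.eval₂ (Int.castRingHom (CategoryTheory.End A)) (η : CategoryTheory.End A)
        (Polynomial.X ^ 2 : Polynomial ℤ))
    (hWalg : weilClassesField A η (R.comp (Polynomial.X ^ 2)) (2 * k) ≤ algebraicClasses A.X k) :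
    weilClassesField A ψ R (2 * (k + k)) ≤ algebraicClasses A.X (k + k) :=
  weilClassesField_sq_le_algebraicClasses rfl (eval₂_zero_ne_zero_of_isWeilTypeCM hW) hW.monic_comp
    hW.natDegree_comp hW.irreducible hW.eval₂_eq_zero (by rw [hW.dim_eq]; ring) hψ hWalg

end HodgeTheory

end Literature.AlgebraicGeometry.HodgeTheory
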